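import Summits.Ventures.PercRepro.S2ContractionCaps

/-!
# PercRepro — S2: THE TRIPLES ALL OF WHOSE PAIRS ARE DEPENDENT, DOUBLE COUNTED (p7, gen 14; sub-claim S2; the case `ν = 4` of `(14, 7)`)

The class `j = 4` of the refined top-`7` count (S2ContractionSeven) charges an independent `4`-point `B ∩ W` by the `3`-subsets of `E ∖ W` all of
whose pairs are dependent in `N = M ／ W`. Each such triple has three dependent pairs and a pair lies in at most `|E ∖ W| − 2` triples:
**`ncard_allpairs_dep_three_mul_three_le`** — `3·#{such triples} ≤ D₂(N)·(|N.E| − 2)` (`Finset.card_mul_le_card_mul`); at nullity `3` on `12`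
points `≤ 6·10/3 = 20` against the `70` of the dependent triples. Axioms: standard.
-/

open scoped Matroid

namespace PercRepro

namespace S2

open Set

variable {α : Type}

open scoped Classical in
/-- **The triples all of whose pairs are dependent, double counted by their pairs.** -/
theorem ncard_allpairs_dep_three_mul_three_le (N : Matroid α) [N.Finite] :
    {X : Set α | X ⊆ N.E ∧ X.ncard = 3 ∧ ∀ x ∈ X, ∀ y ∈ X, x ≠ y → N.Dep {x, y}}.ncard * 3 ≤
      {P : Set α | P ⊆ N.E ∧ P.ncard = 2 ∧ N.Dep P}.ncard * (N.E.ncard - 2) := by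
  have hEfin : N.E.Finite := N.ground_finite
  set Ef : Finset α := hEfin.toFinset with hEf
  have hEfc : (Ef : Set α) = N.E := Set.Finite.coe_toFinset _
  set s : Finset (Set α) := (Matroid.subsF Ef 3).filter (fun X => ∀ x ∈ X, ∀ y ∈ X, x ≠ y → N.Dep {x, y}) with hsdef
  set t : Finset (Set α) := (Matroid.subsF Ef 2).filter (fun P => N.Dep P) with htdef
  have hmem_s : ∀ X, X ∈ s ↔ X ⊆ N.E ∧ X.ncard = 3 ∧ ∀ x ∈ X, ∀ y ∈ X, x ≠ y → N.Dep {x, y} := by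
    intro X
    rw [hsdef, Finset.mem_filter, mem_subsF_iff, hEfc]
    tauto
  have hmem_t : ∀ P, P ∈ t ↔ P ⊆ N.E ∧ P.ncard = 2 ∧ N.Dep P := by
    intro P
    rw [htdef, Finset.mem_filter, mem_subsF_iff, hEfc]
    tauto
  have hcard_s : {X : Set α | X ⊆ N.E ∧ X.ncard = 3 ∧ ∀ x ∈ X, ∀ y ∈ X, x ≠ y → N.Dep {x, y}}.ncard = s.card := by
    rw [← Set.ncard_coe_finset s]
    congr 1
    ext X
    rw [Finset.mem_coe, hmem_s]
    rfl
  have hcard_t : {P : Set α | P ⊆ N.E ∧ P.ncard = 2 ∧ N.Dep P}.ncard = t.card := by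
    rw [← Set.ncard_coe_finset t]
    congr 1
    ext P
    rw [Finset.mem_coe, hmem_t]
    rfl
  rw [hcard_s, hcard_t]
  refine Finset.card_mul_le_card_mul (fun (X : Set α) (P : Set α) => P ⊆ X) ?_ ?_
  · -- each triple has three dependent pairs below it
    intro X hX
    obtain ⟨hXE, hX3, hpairs⟩ := (hmem_s X).1 hX
    obtain ⟨a, b, c, hab, hac, hbc, rfl⟩ := Set.ncard_eq_three.1 hX3
    have hpair : ∀ {u v : α}, u ∈ ({a, b, c} : Set α) → v ∈ ({a, b, c} : Set α) → u ≠ v →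
        ({u, v} : Set α) ∈ t.bipartiteAbove (fun (X : Set α) (P : Set α) => P ⊆ X) {a, b, c} := by
      intro u v hu hv huv
      rw [Finset.mem_bipartiteAbove, hmem_t]
      exact ⟨⟨(Set.pair_subset hu hv).trans hXE, Set.ncard_pair huv, hpairs u hu v hv huv⟩, Set.pair_subset hu hv⟩
    have h1 := hpair (Set.mem_insert a _) (Set.mem_insert_of_mem a (Set.mem_insert b _)) hab
    have h2 := hpair (Set.mem_insert a _) (Set.mem_insert_of_mem a (Set.mem_insert_of_mem b rfl)) hac
    have h3 := hpair (Set.mem_insert_of_mem a (Set.mem_insert b _)) (Set.mem_insert_of_mem a (Set.mem_insert_of_mem b rfl)) hbc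
    have hne12 : ({a, b} : Set α) ≠ {a, c} := fun h => hbc (by
      have : b ∈ ({a, c} : Set α) := h ▸ Set.mem_insert_of_mem a rfl
      rcases this with h' | h'
      · exact absurd h' hab.symm
      · exact h')
    have hne13 : ({a, b} : Set α) ≠ {b, c} := fun h => hac (by
      have : a ∈ ({b, c} : Set α) := h ▸ Set.mem_insert a _
      rcases this with h' | h'
      · exact absurd h' hab
      · exact h')
    have hne23 : ({a, c} : Set α) ≠ {b, c} := fun h => hab (by
      have : a ∈ ({b, c} : Set α) := h ▸ Set.mem_insert a _
      rcases this with h' | h'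
      · exact h'
      · exact absurd h' hac)
    calc 3 = ({({a, b} : Set α), {a, c}, {b, c}} : Finset (Set α)).card := by
          rw [Finset.card_insert_of_notMem, Finset.card_pair hne23]
          simp only [Finset.mem_insert, Finset.mem_singleton, not_or]
          exact ⟨hne12, hne13⟩
      _ ≤ _ := Finset.card_le_card (by
          intro P hP
          simp only [Finset.mem_insert, Finset.mem_singleton] at hP
          rcases hP with rfl | rfl | rfl
          · exact h1
          · exact h2
          · exact h3)
  · -- a pair lies in at most `|E| − 2` triples
    intro P hP
    obtain ⟨hPE, hP2, -⟩ := (hmem_t P).1 hP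
    have hsub : ((s.bipartiteBelow (fun (X : Set α) (P : Set α) => P ⊆ X) P : Finset (Set α)) : Set (Set α)) ⊆
        {X : Set α | X ⊆ N.E ∧ X.ncard = 3 ∧ P ⊆ X} := by
      intro X hX
      rw [Finset.mem_coe, Finset.mem_bipartiteBelow] at hX
      obtain ⟨hXs, hPX⟩ := hX
      obtain ⟨hXE, hX3, -⟩ := (hmem_s X).1 hXs
      exact ⟨hXE, hX3, hPX⟩
    have h := ncard_subsets_superset_le N hPE 3
    rw [hP2] at h
    rw [Nat.choose_one_right] at h
    calc (s.bipartiteBelow (fun (X : Set α) (P : Set α) => P ⊆ X) P).card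
        = ((s.bipartiteBelow (fun (X : Set α) (P : Set α) => P ⊆ X) P : Finset (Set α)) : Set (Set α)).ncard :=
          (Set.ncard_coe_finset _).symm
      _ ≤ {X : Set α | X ⊆ N.E ∧ X.ncard = 3 ∧ P ⊆ X}.ncard :=
          Set.ncard_le_ncard hsub (hEfin.finite_subsets.subset (fun X hX => hX.1))
      _ ≤ N.E.ncard - 2 := h

end S2

end PercRepro
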